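import Literature.AlgebraicGeometry.Frobenioids.ArchimedeanSlitCore
import HarnessLib

/-!
# Frobenioids II, Example 3.3 (v): slit morphisms of `A`, `N`, `R` are FSMI-morphisms — PROOFS

Mochizuki, *The geometry of Frobenioids II: poly-Frobenioids*, Kyushu J. Math. **62** (2008)
401–460, §3, Example 3.3 (v), author's text p. 29 [cite: MochizukiFrdII2008, Ex 3.3 (v) p.29]:
"if `F = A, N, R`, then we shall refer to as a slit morphism any morphism of `F` that is obtained as the
isotropic hull of an object of `F` whose angular region is determined by the complement in `S¹` of a
single element of `S¹`. One verifies immediately that slit morphisms … are FSMI-morphisms. In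
particular, the existence of slit morphisms implies that `F` is not of FSM-type."

DISCHARGES `Ex33v_slit_isFSMI_A/N/R π` (under Example 3.3's standing hypothesis "`D` totally
epimorphic", p. 28 — carried by the statements) and `Ex33v_not_FSMType_A/N/R π` (for every base:
slit morphisms are non-invertible FSM-morphisms regardless of `D`), by transporting the `C`-level
core (`ArchimedeanSlitCore.lean`: `C.exists_fill`, `C.isIso_or_isIso_of_fac`, `C.not_isIso_of_slit`)
along the inclusions `A ⊆ C`, `N ⊆ A` and the faithful functor `R → C`.
-/

namespace Literature.AlgebraicGeometry.Frobenioids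

open CategoryTheory
open scoped Pointwise

noncomputable section

namespace ArchFrd

universe v u

variable {D : Type u} [Category.{v} D] (π : D ⥤ D0)

/-! ### Small transport lemmas -/

namespace C0

/-- The inverse of an isometric isomorphism of `C₀` is an isometry (`Φ₀ = ℝ_{≥0}` is sharp).
[cite: MochizukiFrdII2008, Ex 3.3 (i) p.28] -/
theorem isIsometry_inv {X Y : C0} (g : X ⟶ Y) [IsIso g] :
    PreFrobenioid.IsIsometry C0.toElem (inv g) :=
  isSharp_nnreal.eq_one_of_isUnit _ (PreFrobenioid.isUnit_div_of_isIso C0.toElem (inv g))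

/-- The inverse of an isomorphism of `C₀` is linear. [cite: MochizukiFrdII2008, Ex 3.3 (i) p.27] -/
theorem degFr_inv {X Y : C0} (g : X ⟶ Y) [IsIso g] : degFr (inv g) = 1 := by
  have h := congrArg degFr (IsIso.hom_inv_id g)
  rw [degFr_comp', degFr_id'] at h
  exact PNat.coe_inj.mp (Nat.eq_one_of_mul_eq_one_left (congrArg PNat.val h))

/-- If a composite of two arrows of `C₀` is linear, both are. [cite: MochizukiFrdII2008, Ex 3.3 (i) p.27] -/
theorem degFr_eq_one_of_comp {X Y Z : C0} (f : X ⟶ Y) (g : Y ⟶ Z) (h : degFr (f ≫ g) = 1) :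
    degFr f = 1 ∧ degFr g = 1 := by
  rw [degFr_comp'] at h
  have h' := congrArg PNat.val h
  rw [PNat.mul_coe] at h'
  exact ⟨PNat.coe_inj.mp (Nat.eq_one_of_mul_eq_one_right h'),
    PNat.coe_inj.mp (Nat.eq_one_of_mul_eq_one_left h')⟩

end C0

variable {π}

/-- An arrow of `A` whose underlying arrow of `C` is invertible is invertible in `A` (the inverse is an
isometry). [cite: MochizukiFrdII2008, Ex 3.3 (iii) p.29] -/
theorem A.isIso_of_isIso_hom {P Q : A π} (f : P ⟶ Q) [IsIso f.hom] : IsIso f := by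
  refine ⟨⟨⟨inv f.hom, C.isIsometry_inv π f.hom⟩, ?_, ?_⟩⟩
  · exact WideSubcategory.hom_ext _ (IsIso.hom_inv_id f.hom)
  · exact WideSubcategory.hom_ext _ (IsIso.inv_hom_id f.hom)

/-- The degree of the inverse of an isomorphism of `C`. [cite: MochizukiFrdII2008, Ex 3.3 (ii) p.28] -/
theorem C.degFr_inv {X Y : C π} (f : X ⟶ Y) [IsIso f] : C0.degFr (inv f).fst = 1 := by
  have h := congrArg (fun k : X ⟶ X => C0.degFr k.fst) (IsIso.hom_inv_id f)
  change C0.degFr (f.fst ≫ (inv f).fst) = C0.degFr (𝟙 X.fst) at h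
  rw [C0.degFr_comp', C0.degFr_id'] at h
  exact PNat.coe_inj.mp (Nat.eq_one_of_mul_eq_one_left (congrArg PNat.val h))

/-- An arrow of `N` whose underlying arrow of `C` is invertible is invertible in `N` (the inverse is a
linear isometry). [cite: MochizukiFrdII2008, Ex 3.3 (iii) p.29] -/
theorem N.isIso_of_isIso_hom {P Q : N π} (f : P ⟶ Q) [IsIso f.hom.hom] : IsIso f := by
  refine ⟨⟨⟨⟨inv f.hom.hom, C.isIsometry_inv π f.hom.hom⟩, C.degFr_inv f.hom.hom⟩, ?_, ?_⟩⟩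
  · exact WideSubcategory.hom_ext _ (WideSubcategory.hom_ext _ (IsIso.hom_inv_id f.hom.hom))
  · exact WideSubcategory.hom_ext _ (WideSubcategory.hom_ext _ (IsIso.inv_hom_id f.hom.hom))

/-- An arrow of `N₀` whose underlying arrow of `C₀` is invertible is invertible in `N₀`.
[cite: MochizukiFrdII2008, Ex 3.3 (iii) p.29] -/
theorem N0.isIso_of_isIso_carrier {P Q : N0} (f : P ⟶ Q) [IsIso (N0.homCarrier f)] : IsIso f := by
  refine ⟨⟨N0.homMk (inv (N0.homCarrier f)) (C0.isIsometry_inv _) (C0.degFr_inv _), ?_, ?_⟩⟩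
  · apply N0.hom_ext
    rw [N0.homCarrier_comp]
    exact IsIso.hom_inv_id _
  · apply N0.hom_ext
    rw [N0.homCarrier_comp]
    exact IsIso.inv_hom_id _

/-- An arrow of `R` whose image in `C` is invertible is invertible in `R`.
[cite: MochizukiFrdII2008, Ex 3.3 (iv) p.29] -/
theorem R.isIso_of_isIso_toC {P Q : R π} (f : P ⟶ Q) [IsIso ((R.toC π).map f)] : IsIso f := by
  haveI : IsIso f.snd := CFP.isIso_snd ((R.toC π).map f)
  haveI : IsIso (N0.homCarrier f.fst.left) := CFP.isIso_fst ((R.toC π).map f)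
  haveI : IsIso f.fst.left := N0.isIso_of_isIso_carrier f.fst.left
  haveI : IsIso ((Over.forget N0.realUnit).map f.fst) := by
    change IsIso f.fst.left; infer_instance
  haveI : IsIso f.fst := isIso_of_reflects_iso f.fst (Over.forget N0.realUnit)
  exact CFP.isIso_of_isIso_fst_snd f

/-! ### `F = A` -/

/-- The data of a slit morphism of `A`, unpacked at the level of `C`. [cite: MochizukiFrdII2008, Ex 3.3 (v) p.29] -/
theorem A.slit_data {X Y : A π} (φ : X ⟶ Y) (h : A.IsSlitMorphism π φ) :
    C0.degFr φ.hom.fst = 1 ∧ IsIso φ.hom.snd ∧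
      ‖(C0.scalar φ.hom.fst : ℂ)‖ * X.obj.fst.tip = Y.obj.fst.tip ∧
      Y.obj.fst.IsNaivelyIsotropic ∧ IsSlitRegion X.obj.fst.region := by
  obtain ⟨⟨-, ⟨hlin, hbase⟩, hY, -⟩, hslit⟩ := h
  have hiso := (A0.isIsometry_iff_norm_mul_tip_pow φ.hom.fst).mp φ.property
  have hlin' : C0.degFr φ.hom.fst = 1 := hlin
  rw [hlin', PNat.one_coe, pow_one] at hiso
  exact ⟨hlin', hbase, hiso,
    (Ex33ii_isotropic_iff_holds π Y.obj).mp ((Ex33iii_isotropic_iff_holds π Y).mp hY), hslit⟩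

/-- Slit morphisms of `A` are FSM-morphisms (every base `D`). [cite: MochizukiFrdII2008, Ex 3.3 (v) p.29] -/
theorem A.isFSM_of_isSlitMorphism {X Y : A π} (φ : X ⟶ Y) (h : A.IsSlitMorphism π φ) : IsFSM φ := by
  obtain ⟨hlin, hbase, hiso, hY, hslit⟩ := A.slit_data φ h
  haveI := hbase
  constructor
  · intro Z γ
    have hisoγ := (A0.isIsometry_iff_norm_mul_tip_pow γ.hom.fst).mp γ.property
    obtain ⟨W, δX, δZ, hsq, hδX, hδZ, -, -⟩ := C.exists_fill φ.hom γ.hom hlin hiso hslit hisoγ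
    exact ⟨⟨W⟩, ⟨δX, hδX⟩, ⟨δZ, hδZ⟩, WideSubcategory.hom_ext _ hsq⟩
  · haveI : Mono φ.hom := Rmk331_C_mono_of_injOn π φ.hom hbase
      (C0.injOn_regionMap_of_degFr_eq_one φ.hom.fst hlin _)
    exact (A.ι π).mono_of_mono_map (by exact (inferInstance : Mono φ.hom))

/-- Slit morphisms of `A` are not isomorphisms. [cite: MochizukiFrdII2008, Ex 3.3 (v) p.29] -/
theorem A.not_isIso_of_isSlitMorphism {X Y : A π} (φ : X ⟶ Y) (h : A.IsSlitMorphism π φ) :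
    ¬ IsIso φ := by
  obtain ⟨-, -, -, hY, hslit⟩ := A.slit_data φ h
  intro hφ
  exact C.not_isIso_of_slit φ.hom hY hslit (inferInstance : IsIso ((A.ι π).map φ))

/-- Slit morphisms of `A` are irreducible when `D` is totally epimorphic. [cite: MochizukiFrdII2008, Ex 3.3 (v) p.29] -/
theorem A.isIrreducibleHom_of_isSlitMorphism (hD : IsTotallyEpimorphic D) {X Y : A π} (φ : X ⟶ Y)
    (h : A.IsSlitMorphism π φ) : IsIrreducibleHom φ := by
  obtain ⟨hlin, hbase, hiso, hY, hslit⟩ := A.slit_data φ h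
  haveI := hbase
  refine ⟨A.not_isIso_of_isSlitMorphism φ h, fun M β α hfac => ?_⟩
  have hfacC : β.hom ≫ α.hom = φ.hom := congrArg InducedWideCategory.Hom.hom hfac
  have hdeg : C0.degFr (β.hom.fst ≫ α.hom.fst) = 1 := by
    have : (β.hom ≫ α.hom).fst = β.hom.fst ≫ α.hom.fst := rfl
    rw [← this, hfacC]; exact hlin
  obtain ⟨hβlin, hαlin⟩ := C0.degFr_eq_one_of_comp _ _ hdeg
  have hβiso := (A0.isIsometry_iff_norm_mul_tip_pow β.hom.fst).mp β.property
  have hαiso := (A0.isIsometry_iff_norm_mul_tip_pow α.hom.fst).mp α.property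
  rw [hβlin, PNat.one_coe, pow_one] at hβiso
  rw [hαlin, PNat.one_coe, pow_one] at hαiso
  rcases C.isIso_or_isIso_of_fac hD φ.hom β.hom α.hom hfacC hslit hβlin hβiso hαlin hαiso with hα | hβ
  · haveI := hα; exact Or.inl (A.isIso_of_isIso_hom α)
  · haveI := hβ; exact Or.inr (A.isIso_of_isIso_hom β)

/-- **Example 3.3 (v), `F = A`** — PROVED. [cite: MochizukiFrdII2008, Ex 3.3 (v) p.29] -/
theorem Ex33v_slit_isFSMI_A_holds : Ex33v_slit_isFSMI_A π := fun hD _ _ φ h =>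
  ⟨A.isFSM_of_isSlitMorphism φ h, A.isIrreducibleHom_of_isSlitMorphism hD φ h⟩

/-- **Example 3.3 (v), `F = A`**: "the existence of slit morphisms implies that `F` is not of FSM-type"
— PROVED (every base). [cite: MochizukiFrdII2008, Ex 3.3 (v) p.29] -/
theorem Ex33v_not_FSMType_A_holds : Ex33v_not_FSMType_A π := by
  rintro ⟨X, Y, φ, h⟩ hFSM
  exact A.not_isIso_of_isSlitMorphism φ h (hFSM.isIso_of_isFSM φ (A.isFSM_of_isSlitMorphism φ h))

/-! ### `F = N` -/

/-- The data of a slit morphism of `N`, unpacked at the level of `C`. [cite: MochizukiFrdII2008, Ex 3.3 (v) p.29] -/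
theorem N.slit_data {X Y : N π} (φ : X ⟶ Y) (h : N.IsSlitMorphism π φ) :
    C0.degFr φ.hom.hom.fst = 1 ∧ IsIso φ.hom.hom.snd ∧
      ‖(C0.scalar φ.hom.hom.fst : ℂ)‖ * X.obj.obj.fst.tip = Y.obj.obj.fst.tip ∧
      Y.obj.obj.fst.IsNaivelyIsotropic ∧ IsSlitRegion X.obj.obj.fst.region := by
  obtain ⟨⟨hisom, ⟨hlin, hbase⟩, hY, -⟩, hslit⟩ := h
  have hiso := (A0.isIsometry_iff_norm_mul_tip_pow φ.hom.hom.fst).mp hisom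
  have hlin' : C0.degFr φ.hom.hom.fst = 1 := hlin
  rw [hlin', PNat.one_coe, pow_one] at hiso
  exact ⟨hlin', hbase, hiso, (Ex33ii_isotropic_iff_holds π Y.obj.obj).mp hY, hslit⟩

/-- Slit morphisms of `N` are FSM-morphisms (every base `D`). [cite: MochizukiFrdII2008, Ex 3.3 (v) p.29] -/
theorem N.isFSM_of_isSlitMorphism {X Y : N π} (φ : X ⟶ Y) (h : N.IsSlitMorphism π φ) : IsFSM φ := by
  obtain ⟨hlin, hbase, hiso, hY, hslit⟩ := N.slit_data φ h
  haveI := hbase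
  constructor
  · intro Z γ
    have hisoγ := (A0.isIsometry_iff_norm_mul_tip_pow γ.hom.hom.fst).mp γ.hom.property
    obtain ⟨W, δX, δZ, hsq, hδX, hδZ, hdX, hdZ⟩ :=
      C.exists_fill φ.hom.hom γ.hom.hom hlin hiso hslit hisoγ
    have hγlin : C0.degFr γ.hom.hom.fst = 1 := γ.property
    refine ⟨⟨⟨W⟩⟩, ⟨⟨δX, hδX⟩, ?_⟩, ⟨⟨δZ, hδZ⟩, ?_⟩,
      WideSubcategory.hom_ext _ (WideSubcategory.hom_ext _ hsq)⟩
    · change C0.degFr δX.fst = 1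
      rw [hdX, hγlin]
    · exact hdZ
  · haveI : Mono φ.hom.hom := Rmk331_C_mono_of_injOn π φ.hom.hom hbase
      (C0.injOn_regionMap_of_degFr_eq_one φ.hom.hom.fst hlin _)
    exact (N.toC π).mono_of_mono_map (by exact (inferInstance : Mono φ.hom.hom))

/-- Slit morphisms of `N` are not isomorphisms. [cite: MochizukiFrdII2008, Ex 3.3 (v) p.29] -/
theorem N.not_isIso_of_isSlitMorphism {X Y : N π} (φ : X ⟶ Y) (h : N.IsSlitMorphism π φ) :
    ¬ IsIso φ := by
  obtain ⟨-, -, -, hY, hslit⟩ := N.slit_data φ h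
  intro hφ
  exact C.not_isIso_of_slit φ.hom.hom hY hslit (inferInstance : IsIso ((N.toC π).map φ))

/-- Slit morphisms of `N` are irreducible when `D` is totally epimorphic. [cite: MochizukiFrdII2008, Ex 3.3 (v) p.29] -/
theorem N.isIrreducibleHom_of_isSlitMorphism (hD : IsTotallyEpimorphic D) {X Y : N π} (φ : X ⟶ Y)
    (h : N.IsSlitMorphism π φ) : IsIrreducibleHom φ := by
  obtain ⟨hlin, hbase, hiso, hY, hslit⟩ := N.slit_data φ h
  haveI := hbase
  refine ⟨N.not_isIso_of_isSlitMorphism φ h, fun M β α hfac => ?_⟩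
  have hfacC : β.hom.hom ≫ α.hom.hom = φ.hom.hom :=
    congrArg InducedWideCategory.Hom.hom (congrArg InducedWideCategory.Hom.hom hfac)
  have hβlin : C0.degFr β.hom.hom.fst = 1 := β.property
  have hαlin : C0.degFr α.hom.hom.fst = 1 := α.property
  have hβiso := (A0.isIsometry_iff_norm_mul_tip_pow β.hom.hom.fst).mp β.hom.property
  have hαiso := (A0.isIsometry_iff_norm_mul_tip_pow α.hom.hom.fst).mp α.hom.property
  rw [hβlin, PNat.one_coe, pow_one] at hβiso
  rw [hαlin, PNat.one_coe, pow_one] at hαiso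
  rcases C.isIso_or_isIso_of_fac hD φ.hom.hom β.hom.hom α.hom.hom hfacC hslit hβlin hβiso hαlin hαiso
    with hα | hβ
  · haveI := hα; exact Or.inl (N.isIso_of_isIso_hom α)
  · haveI := hβ; exact Or.inr (N.isIso_of_isIso_hom β)

/-- **Example 3.3 (v), `F = N`** — PROVED. [cite: MochizukiFrdII2008, Ex 3.3 (v) p.29] -/
theorem Ex33v_slit_isFSMI_N_holds : Ex33v_slit_isFSMI_N π := fun hD _ _ φ h =>
  ⟨N.isFSM_of_isSlitMorphism φ h, N.isIrreducibleHom_of_isSlitMorphism hD φ h⟩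

/-- **Example 3.3 (v), `F = N`**: not of FSM-type — PROVED (every base). [cite: MochizukiFrdII2008, Ex 3.3 (v) p.29] -/
theorem Ex33v_not_FSMType_N_holds : Ex33v_not_FSMType_N π := by
  rintro ⟨X, Y, φ, h⟩ hFSM
  exact N.not_isIso_of_isSlitMorphism φ h (hFSM.isIso_of_isFSM φ (N.isFSM_of_isSlitMorphism φ h))

/-! ### `F = R` -/

/-- The data of a slit morphism of `R`, unpacked at the level of `C`. [cite: MochizukiFrdII2008, Ex 3.3 (v) p.29] -/
theorem R.slit_data {X Y : R π} (φ : X ⟶ Y) (h : R.IsSlitMorphism π φ) :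
    C0.degFr ((R.toC π).map φ).fst = 1 ∧ IsIso ((R.toC π).map φ).snd ∧
      ‖(C0.scalar ((R.toC π).map φ).fst : ℂ)‖ * ((R.toC π).obj X).fst.tip = ((R.toC π).obj Y).fst.tip ∧
      ((R.toC π).obj Y).fst.IsNaivelyIsotropic ∧ IsSlitRegion ((R.toC π).obj X).fst.region := by
  obtain ⟨⟨hisom, ⟨hlin, hbase⟩, hY, -⟩, hslit⟩ := h
  have hiso := (A0.isIsometry_iff_norm_mul_tip_pow ((R.toC π).map φ).fst).mp hisom
  have hlin' : C0.degFr ((R.toC π).map φ).fst = 1 := hlin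
  rw [hlin', PNat.one_coe, pow_one] at hiso
  exact ⟨hlin', hbase, hiso, (Ex33ii_isotropic_iff_holds π _).mp hY, hslit⟩

/-- Slit morphisms of `R` are FSM-morphisms (every base `D`). [cite: MochizukiFrdII2008, Ex 3.3 (v) p.29] -/
theorem R.isFSM_of_isSlitMorphism {X Y : R π} (φ : X ⟶ Y) (h : R.IsSlitMorphism π φ) : IsFSM φ := by
  obtain ⟨hlin, hbase, hiso, hY, hslit⟩ := R.slit_data φ h
  haveI := hbase
  constructor
  · intro Z γ
    have hisoγ := (A0.isIsometry_iff_norm_mul_tip_pow ((R.toC π).map γ).fst).mp γ.fst.left.1.2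
    obtain ⟨W, δX, δZ, hsq, hδX, hδZ, hdX, hdZ⟩ :=
      C.exists_fill ((R.toC π).map φ) ((R.toC π).map γ) hlin hiso hslit hisoγ
    have hγlin : C0.degFr ((R.toC π).map γ).fst = 1 := γ.fst.left.2
    -- the `N₀`-lifts of the two legs
    let WN : N0 := ⟨⟨W.fst⟩⟩
    let δZN : WN ⟶ Z.fst.left := N0.homMk δZ.fst hδZ hdZ
    let δXN : WN ⟶ X.fst.left := N0.homMk δX.fst hδX (by rw [hdX, hγlin])
    have hsq1 : δX.fst ≫ N0.homCarrier φ.fst.left = δZ.fst ≫ N0.homCarrier γ.fst.left :=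
      congrArg CFP.Hom.fst hsq
    have hsq2 : δX.snd ≫ φ.snd = δZ.snd ≫ γ.snd := congrArg CFP.Hom.snd hsq
    have hsqN : δXN ≫ φ.fst.left = δZN ≫ γ.fst.left := by
      apply N0.hom_ext
      rw [N0.homCarrier_comp, N0.homCarrier_comp]
      exact hsq1
    have hcomm : δXN ≫ X.fst.hom = δZN ≫ Z.fst.hom := by
      rw [← Over.w φ.fst, ← Over.w γ.fst, ← Category.assoc, ← Category.assoc, hsqN]
    let WR : R π := ⟨Over.mk (δZN ≫ Z.fst.hom), W.snd, W.iso⟩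
    let δXR : WR ⟶ X := ⟨Over.homMk δXN hcomm, δX.snd, δX.w⟩
    let δZR : WR ⟶ Z := ⟨Over.homMk δZN rfl, δZ.snd, δZ.w⟩
    refine ⟨WR, δXR, δZR, ?_⟩
    refine CFP.hom_ext (Over.OverMorphism.ext ?_) hsq2
    change δXN ≫ φ.fst.left = δZN ≫ γ.fst.left
    exact hsqN
  · haveI : Mono ((R.toC π).map φ) := Rmk331_C_mono_of_injOn π _ hbase
      (C0.injOn_regionMap_of_degFr_eq_one _ hlin _)
    exact (R.toC π).mono_of_mono_map inferInstance

/-- Slit morphisms of `R` are not isomorphisms. [cite: MochizukiFrdII2008, Ex 3.3 (v) p.29] -/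
theorem R.not_isIso_of_isSlitMorphism {X Y : R π} (φ : X ⟶ Y) (h : R.IsSlitMorphism π φ) :
    ¬ IsIso φ := by
  obtain ⟨-, -, -, hY, hslit⟩ := R.slit_data φ h
  intro hφ
  exact C.not_isIso_of_slit ((R.toC π).map φ) hY hslit inferInstance

/-- Slit morphisms of `R` are irreducible when `D` is totally epimorphic. [cite: MochizukiFrdII2008, Ex 3.3 (v) p.29] -/
theorem R.isIrreducibleHom_of_isSlitMorphism (hD : IsTotallyEpimorphic D) {X Y : R π} (φ : X ⟶ Y)
    (h : R.IsSlitMorphism π φ) : IsIrreducibleHom φ := by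
  obtain ⟨hlin, hbase, hiso, hY, hslit⟩ := R.slit_data φ h
  haveI := hbase
  refine ⟨R.not_isIso_of_isSlitMorphism φ h, fun M β α hfac => ?_⟩
  have hfacC : (R.toC π).map β ≫ (R.toC π).map α = (R.toC π).map φ := by
    rw [← Functor.map_comp, hfac]
  have hβlin : C0.degFr ((R.toC π).map β).fst = 1 := β.fst.left.2
  have hαlin : C0.degFr ((R.toC π).map α).fst = 1 := α.fst.left.2
  have hβiso := (A0.isIsometry_iff_norm_mul_tip_pow ((R.toC π).map β).fst).mp β.fst.left.1.2
  have hαiso := (A0.isIsometry_iff_norm_mul_tip_pow ((R.toC π).map α).fst).mp α.fst.left.1.2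
  rw [hβlin, PNat.one_coe, pow_one] at hβiso
  rw [hαlin, PNat.one_coe, pow_one] at hαiso
  rcases C.isIso_or_isIso_of_fac hD _ _ _ hfacC hslit hβlin hβiso hαlin hαiso with hα | hβ
  · haveI := hα; exact Or.inl (R.isIso_of_isIso_toC α)
  · haveI := hβ; exact Or.inr (R.isIso_of_isIso_toC β)

/-- **Example 3.3 (v), `F = R`** — PROVED. [cite: MochizukiFrdII2008, Ex 3.3 (v) p.29] -/
theorem Ex33v_slit_isFSMI_R_holds : Ex33v_slit_isFSMI_R π := fun hD _ _ φ h =>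
  ⟨R.isFSM_of_isSlitMorphism φ h, R.isIrreducibleHom_of_isSlitMorphism hD φ h⟩

/-- **Example 3.3 (v), `F = R`**: not of FSM-type — PROVED (every base). [cite: MochizukiFrdII2008, Ex 3.3 (v) p.29] -/
theorem Ex33v_not_FSMType_R_holds : Ex33v_not_FSMType_R π := by
  rintro ⟨X, Y, φ, h⟩ hFSM
  exact R.not_isIso_of_isSlitMorphism φ h (hFSM.isIso_of_isFSM φ (R.isFSM_of_isSlitMorphism φ h))

end ArchFrd

end

end Literature.AlgebraicGeometry.Frobenioids
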